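import Summits.Ventures.YMGap.Census.Decimation
import Summits.Ventures.YMGap.Census.DecimationInterpolated
import Summits.Ventures.YMGap.Census.DecimationTwist
import Summits.Ventures.YMGap.Census.DecimationTwistPlus
import Summits.Ventures.YMGap.Census.DecimationLowerBound
import Summits.Ventures.YMGap.Census.TwoDimExactRows
import Summits.Ventures.YMGap.Census.TwoDimDecimation
import Summits.Ventures.YMGap.RobustBall.RobustAreaLawVertex
import HarnessLib

/-!
# Venture statement — YMGap (cell `pub-ymgap`) — CONJUNCT BODIES for the v1.6 append of `Statement.lean` (T30, T31; PLAN R201)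

STATUS: DRAFT (seat p3-g4). Per R201 this block goes to the gate only after the v1.5 index append has its verdict; T29 (the
track-Y4 YM₃ sentence) joins it, or a later block, after the Sunday item-(15) ruling; T30 enters only with lit-2's
`Census/DecimationTwist.lean` (p347508) ACCEPTED — its UAtwist clause is typed below.

HONEST FRAMING. WHAT THIS IS: bodies `Tk_… : Prop` + witnesses `Tk_…_holds` of two conjuncts of the venture statement (index of
record: `Summits/Ventures/YMGap/Statement.lean`, append-only). Both are kernel-checked and carry NO hypothesis:
* **T30** (track (b)): Tomboulis's DECIMATION propositions (arXiv:0707.2179 §3, §4, App. A) as theorems on FINITE tori — Prop.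
  III.1 (3.4) (the potential-moving upper bound) for every dimension `d`, scale `b`, coarse side `L`, cut-off `J` and exponent
  parameter `0 ≤ r ≤ 1` (even `L`; `r = 1` for every `L`), its twisted companion (UAtwist, `r = 1`) and Prop. IV.3 (4.12) for `Z⁺` (every `0 ≤ r ≤ 1`, even `L`), all on
  the POSITIVITY DOMAIN `f_c ≥ 0` of the plaquette function (T07's standing hypothesis (2.34)); Prop. III.2 (3.7) with `b = 3` in
  `d = 3, 4`; and the exactly solvable two-dimensional rows, including the FAILURE of the disputed (5.15) AS TYPED in `d = 2`
  where `Z⁻` changes sign. Identities and inequalities between Haar integrals of truncated character expansions; NOTHING about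
  (5.15) in `d ≥ 3`, the thermodynamic limit, confinement or a mass gap.
* **T31** (track Y2): the Wilson AREA LAW uniformly on the torus ball `RobustBall.ClusterDomainFR ε₀ ε₁ r` with a vertical
  dependence window `mv`, through the AFFINE-VERTEX slab door — every `N ≥ 2`, every dimension, Bakry–Émery-fed — and the
  `SU(2)`, `d = 4` vertex rows `(1/3; 3/10, 3/20)`, `(1/2; 3/25, 3/50)` (larger balls than T26's). Strong-coupling lattice
  statements; every radius is where a DOOR closes; no tier-2 (window-free) area law (refuted, T28); nothing continuum.
WHAT THIS IS NOT: no continuum statement, no verdict on (5.15) in `d ≥ 3`, no claim on the Yang–Mills Millennium problem.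
-/

noncomputable section

namespace Summit.Ventures.YMGap

open Literature.MathematicalPhysics.QuantumLattice
open Literature.MathematicalPhysics.QuantumFieldTheory
open Literature.MathematicalPhysics.QuantumFieldTheory.Tomboulis2007
open Summit.Ventures.YMGap.RobustBall

/-- **T30 — track (b): Tomboulis's DECIMATION propositions as kernel theorems, UNCONDITIONAL** (arXiv:0707.2179; one
decimation step `(ℤ/bL)^d → (ℤ/L)^d`, `ζ = b^{d-2}`, decimated coefficients `c^U_j(1,r)` and bulk factor `F₀^U(1)`; on the
POSITIVITY DOMAIN `f_c ≥ 0` where stated): (i) Prop. III.1 (3.4)/(A.19): for every `d, b, L ≥ 1`, every `J`, every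
`0 ≤ r ≤ 1` with `L` even, `Z_{(ℤ/bL)^d}({c_j}) ≤ F₀^U(1)^{#plaquettes((ℤ/L)^d)} · Z_{(ℤ/L)^d}({c^U_j(1,r)})`
(`Census.decimationUpperBound_of_nonneg_of_le_one`, seat lit-2; at `r = 1` for every `L`: `Census.decimationUpperBound_of_nonneg`);
(ii) its twisted companion (UAtwist, App. A §4) at `r = 1`, every `d, b`, `L ≥ 2`, `J`, plane `i < j`:
`Z⁻_{(ℤ/bL)^d}({c_j}; 𝒱_{ij}) ≤ F₀^U(1)^{#plaquettes} · Z⁻_{(ℤ/L)^d}({c^U_j(1,1)}; 𝒱_{ij})`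
(`Census.twistedDecimationUpperBound_of_nonneg`) and hence Prop. IV.3 (4.12) for `Z⁺ = (Z + Z⁻)/2`, every `0 ≤ r ≤ 1` on an even
coarse torus (`Census.decimationUpperBoundPlus_of_nonneg_of_le_one`, via IV.2 (i)); (iii) Prop. III.2 (3.7), the LOWER bound
`Z_{(ℤ/L)^d}({c_j^6}) ≤ Z_{(ℤ/3L)^d}({c_j})` (`b = 3`) in `d = 3` and `d = 4`, every even `L`, every `J`, every admissible `c`
(`Census.decimationLowerBound_three_d3/_d4`; `b = 2` is NOT covered by the tree's quarter exponent and is not claimed);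
(iv) `d = 2`, every `L`, `J`: IV.1 for every twist set (`Census.twistLe_two`), (5.24) for every admissible `c`
(`Census.vortexRatioAntitone_two`), the decimation is EXACT — III.1 with `F₀^U = 1` (`Census.decimationUpperBound_two`) and
(5.22) (`Census.mktLowerBound_two`); (v) `d = 2`: the disputed (5.15) AS TYPED (`Ineq515`, log-derivative form) FAILS on every
odd twist set for `c = 𝟙_{n ∈ {1,3}}`, `J = 3` (`Census.not_ineq515_two_indicator`: `Z⁻` changes sign on the ray). Finite tori only. -/
def T30_TomboulisDecimationBounds : Prop :=
  (∀ (d L b : ℕ) [NeZero d] [NeZero b] [NeZero L], Even L → ∀ (J : ℕ) (c : ℕ → ℝ), CoeffAdmissible c →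
      (∀ g : Tomboulis2007.SU2, 0 ≤ plaqFn J c g) → ∀ r : ℝ, 0 ≤ r → r ≤ 1 →
        torusZ d (b * L) J c ≤
          mkF0 J c (b ^ (d - 2)) b ^ Fintype.card (Plaquette d L) *
            torusZ d L (b ^ (d - 2) * J) (mkCoeff J c (b ^ (d - 2)) b r)) ∧
    (∀ (d L b : ℕ) [NeZero b] [NeZero L] [Fact (1 < L)] (i j : Fin d) (hij : i < j) (J : ℕ) (c : ℕ → ℝ),
      CoeffAdmissible c → (∀ g : Tomboulis2007.SU2, 0 ≤ plaqFn J c g) →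
        torusZtw d (b * L) J c (vortexSheet (b * L) i j hij) ≤
          mkF0 J c (b ^ (d - 2)) b ^ Fintype.card (Plaquette d L) *
            torusZtw d L (b ^ (d - 2) * J) (mkCoeff J c (b ^ (d - 2)) b 1) (vortexSheet L i j hij)) ∧
    (∀ (d L b : ℕ) [NeZero b] [NeZero L], Even L → ∀ (i j : Fin d) (hij : i < j) (J : ℕ) (c : ℕ → ℝ),
      CoeffAdmissible c → (∀ g : Tomboulis2007.SU2, 0 ≤ plaqFn J c g) → ∀ r : ℝ, 0 ≤ r → r ≤ 1 →
        torusZplus d (b * L) J c (vortexSheet (b * L) i j hij) ≤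
          mkF0 J c (b ^ (d - 2)) b ^ Fintype.card (Plaquette d L) *
            torusZplus d L (b ^ (d - 2) * J) (mkCoeff J c (b ^ (d - 2)) b r) (vortexSheet L i j hij)) ∧
    (∀ (L : ℕ) [NeZero L], Even L → ∀ J : ℕ, DecimationLowerBound 3 L 3 J ∧ DecimationLowerBound 4 L 3 J) ∧
    (∀ (L : ℕ) [NeZero L] (J : ℕ),
      (∀ V : Finset (Plaquette 2 L), TwistLe 2 L J V) ∧
        (∀ c : ℕ → ℝ, CoeffAdmissible c → ∀ V : Finset (Plaquette 2 L), VortexRatioAntitone 2 L J c V) ∧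
        (∀ (b : ℕ) [NeZero (b * L)], DecimationUpperBound 2 L b J 1 ∧
          ∀ h01 : (0 : Fin 2) < 1, MKTLowerBound (d := 2) L b J 1 0 1 h01)) ∧
    (∀ (L : ℕ) [NeZero L] (V : Finset (Plaquette 2 L)), Odd V.card →
      ¬ Ineq515 2 L 3 (fun n => if n = 1 ∨ n = 3 then (1 : ℝ) else 0) V)

/-- T30 holds (`Census.decimationUpperBound_of_nonneg_of_le_one`, `Census.twistedDecimationUpperBound_of_nonneg`,
`Census.decimationUpperBoundPlus_of_nonneg_of_le_one`, `Census.decimationLowerBound_three_d3/_d4`, `Census.twistLe_two`,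
`Census.vortexRatioAntitone_two`, `Census.decimationUpperBound_two`, `Census.mktLowerBound_two`, `Census.not_ineq515_two_indicator`). -/
theorem T30_TomboulisDecimationBounds_holds : T30_TomboulisDecimationBounds :=
  ⟨fun _ _ _ _ _ _ hL J _ hc hf _ hr0 hr1 => Census.decimationUpperBound_of_nonneg_of_le_one hL J hc hf hr0 hr1,
    fun _ _ _ _ _ _ _ _ hij J _ hc hf => Census.twistedDecimationUpperBound_of_nonneg hij J hc hf,
    fun _ _ _ _ _ hL _ _ hij J _ hc hf _ hr0 hr1 => Census.decimationUpperBoundPlus_of_nonneg_of_le_one hL hij J hc hf hr0 hr1,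
    fun _ _ hL J => ⟨Census.decimationLowerBound_three_d3 hL J, Census.decimationLowerBound_three_d4 hL J⟩,
    fun _ _ J => ⟨fun V => Census.twistLe_two J V, fun _ hc V => Census.vortexRatioAntitone_two J hc V,
      fun b _ => ⟨Census.decimationUpperBound_two b J, fun h01 => Census.mktLowerBound_two b J h01⟩⟩,
    fun _ _ V hV => Census.not_ineq515_two_indicator V hV⟩

/-- **T31 — track Y2: the WILSON AREA LAW UNIFORMLY ON THE TORUS BALL through the AFFINE-VERTEX slab door, HYPOTHESIS-FREE**
(`AreaLawOnBall N d β ε₀ ε₁ r mv`: constants `C, c > 0` with `|⟨W_{R×T}⟩| ≤ C^{2(R+T)} e^{−cRT}` on every torus, for every member of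
`ClusterDomainFR ε₀ ε₁ r` slab-local with vertical window `mv`, every rectangle with `2R, 2T ≤ L`): (i) EVERY `N ≥ 2`, EVERY slice
dimension `n` (`d = n + 1`), every tree coupling `β` with slab radius `R = 2n|β/N| < 1/2`, every range `r`, every `mv ≥ 1`, and all radii
`ε₀, ε₁` with `e^{ε₀} c_W (1 + 2√N ε₁) < 1` and `e^{ε₀} c_W + √N ε₁ < 1`, `c_W = R/(1/2 − R)` (Bakry–Émery one-link modulus,
Shen–Zhu–Zhu Lemma 4.1): `AreaLawOnBall N (n+1) β ε₀ ε₁ r mv` (`RobustBall.areaLawOnBall_SU_of_bakryEmery`, seat rb-p2; at `ε₀ = ε₁ = 0`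
the Wilson threshold `β/N < 1/(8(d−1))` of Cao–Nissim–Sheffield's Thm 1.6); (ii) `SU(2)`, `d = 4` (quarter modulus, `c_W = 3β_W/2`, tree
coupling `β_W/2`): the vertex rows `(β_W; ε₀, ε₁) = (1/3; 3/10, 3/20)` and `(1/2; 3/25, 3/50)`, every `r`, every `mv ≥ 1`
(`RobustBall.su2_areaLawOnBall_oneThird_vertex/_oneHalf_vertex`; strictly larger balls than T26's `(1/5, 1/10)`, `(2/25, 1/25)`).
Strong-coupling lattice statements; no tier-2 (window-free) area law (T28). -/
def T31_BallAreaLawVertex : Prop :=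
  (∀ (N n : ℕ), 2 ≤ N → ∀ β : ℝ, |β / N| * (2 * (n : ℝ)) < 1 / 2 → ∀ (ε₀ ε₁ : ℝ) (r mv : ℕ), 1 ≤ mv →
      Real.exp ε₀ * (|β / N| * (2 * (n : ℝ)) / (1 / 2 - |β / N| * (2 * (n : ℝ)))) * (1 + 2 * Real.sqrt N * ε₁) < 1 →
      Real.exp ε₀ * (|β / N| * (2 * (n : ℝ)) / (1 / 2 - |β / N| * (2 * (n : ℝ)))) + Real.sqrt N * ε₁ < 1 →
        AreaLawOnBall N (n + 1) β ε₀ ε₁ r mv) ∧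
    (∀ (r mv : ℕ), 1 ≤ mv →
      AreaLawOnBall 2 4 (1 / 6) (3 / 10) (3 / 20) r mv ∧ AreaLawOnBall 2 4 (1 / 4) (3 / 25) (3 / 50) r mv)

/-- T31 holds (`RobustBall.areaLawOnBall_SU_of_bakryEmery`, `RobustBall.su2_areaLawOnBall_oneThird_vertex`,
`RobustBall.su2_areaLawOnBall_oneHalf_vertex`). -/
theorem T31_BallAreaLawVertex_holds : T31_BallAreaLawVertex :=
  ⟨fun _ _ hN β hR _ _ r _ hmv hv1 hv2 => areaLawOnBall_SU_of_bakryEmery hN β hR r hmv hv1 hv2,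
    fun r _ hmv => ⟨su2_areaLawOnBall_oneThird_vertex r hmv, su2_areaLawOnBall_oneHalf_vertex r hmv⟩⟩

end Summit.Ventures.YMGap

end
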